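import Mathlib.RingTheory.Ideal.Span
import Mathlib.RingTheory.Ideal.Operations
import Mathlib.Tactic.LinearCombination
import Mathlib.Tactic.Ring
import HarnessLib

/-!
# Chart algebra of the isolated-side specimen `x₀²x₃² + x₁⁴ + x₂⁴` (T-ISO-1): two points, then two carrier lines

[OURS · L1 W4.5(b)] Support file for the research stub `stub_elnat_three_isolated` of the crux
`EquisingularLiftNat` (stmt-ResolutionOfSingularities-20038; route `EquisingularLift`, chain w45b,
CHAIN v7 §3 row T-ISO-1, res-L1-w45b-lead-2 RESHAPE v3: «isolated-side kernel specimen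
`H = V(x₀²x₃² + x₁⁴ + x₂⁴) ⊂ ℙ³_k`, `p ≠ 2`: two points `z² + x⁴ + y⁴`; section, then nose = an `O`-line
inside the carrier, 4 horizontal steps»). NOT a statement of any manuscript; AI-written kernel-checked
polynomial identities of the cell `res-hironaka` (weaker than expert review) — the DOWNSTAIRS
(special-fibre) chart computation only; the scheme-level `ELNatOver` statement for the specimen needs the
transport adapters R0′/R1 of CHAIN v7 and is NOT here.

Everything is stated over an arbitrary commutative ring `R`; the smoothness certificates assume that
`2` is a unit (`p ≠ 2`).

* §1 `specimen_chart_x3` / `specimen_chart_x0`: on `x₃ = 1` (resp. `x₀ = 1`) the specimen is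
  `f = z² + x⁴ + y⁴`; `specimen_jacobian_x/y/z`: for `2 ∈ Rˣ` the Jacobian ideal of `f` contains
  `z, x³, y³`, so `Sing V(f) ⊆ {x = y = z = 0}` — the two singular points `[1:0:0:0]`, `[0:0:0:1]`;
  `specimen_chart_x1_smooth`: on `x₁ = 1` (and symmetrically `x₂ = 1`) the dehomogenised polynomial
  `x₀²x₃² + 1 + x₂⁴` and its `x₀`-, `x₂`-derivatives generate `(1)` when `2 ∈ Rˣ` (no singular points
  there).
* §2 point blow-up of the origin of `z² + x⁴ + y⁴` — charts `pointBlowup_chartX/Y/Z`: total transform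
  `=` (exceptional)² `·` strict transform, strict transforms `z₁² + x²(1 + y₁⁴)`, `z₁² + y²(x₁⁴ + 1)`,
  `1 + z²(x₁⁴ + y₁⁴)`; `pointBlowup_chartZ_misses`: the last is `≡ 1 mod z` (the strict transform does
  not meet the exceptional divisor in the `z`-chart).
* §3 `strictTransform_jacobian_z₁/x_sq`: for `f₁ = z₁² + x²(1 + y₁⁴)` and `2 ∈ Rˣ` the Jacobian ideal
  contains `z₁` and `x²`: `Sing H₁ ⊆ ℓ := {x = z₁ = 0}`, the exceptional LINE inside the carrier
  `E ≅ ℙ²` (and `f₁ ∈ (x, z₁)²`, `strictTransform_mem_sq`: `H₁` is singular all along `ℓ`, an `A₁`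
  double line — after the section the singularity is NO LONGER isolated; the next centre is the
  carrier line `ℓ`, liftable as an `O`-line in `E ≅ ℙ²_O`); `strictTransform_sub_sq_eq`: `H₁ ∩ E = 2ℓ`.
* §4 blow-up of `ℓ` — charts `lineBlowup_chartA/B`: `f₁ = x²(z₂² + 1 + y₁⁴)` (`z₁ = x z₂`),
  `f₁ = z₁²(1 + x₂²(1 + y₁⁴))` (`x = z₁x₂`); `lineBlowup_chartA_smooth`, `lineBlowup_chartB_smooth`:
  Nullstellensatz certificates that the strict transforms have unit Jacobian ideal when `2 ∈ Rˣ` —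
  REGULAR. By the `x ↔ y` symmetry of `f` (`specimen_symm`) the `y`-chart is identical. Net downstairs
  resolution: 2 point blow-ups + 2 line blow-ups (one per singular point) = 4 steps, every centre regular
  and contained in the current strict transform (`E1`), as RESHAPE v3 predicts.

References: elementary [folklore]; the specimen is lead-2's (cell-internal LEAD-MEMO-1 / RESHAPE v3).
-/

-- single-problem summit: the doubled namespace component `ResolutionOfSingularities` is forced
set_option linter.dupNamespace false

namespace Summit.ResolutionOfSingularities.ResolutionOfSingularities.Theorems.EquisingularLift.SpecimenQuartic

variable {R : Type} [CommRing R]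

/-! ## §1 The specimen and its affine charts -/

/-- The specimen is symmetric in `x₁ ↔ x₂` and in `x₀ ↔ x₃`. [folklore] -/
theorem specimen_symm (x₀ x₁ x₂ x₃ : R) :
    x₀ ^ 2 * x₃ ^ 2 + x₁ ^ 4 + x₂ ^ 4 = x₃ ^ 2 * x₀ ^ 2 + x₂ ^ 4 + x₁ ^ 4 := by
  ring

/-- Chart `x₃ = 1`: the specimen becomes `z² + x⁴ + y⁴` with `z = x₀`, `x = x₁`, `y = x₂`. [folklore] -/
theorem specimen_chart_x3 (x₀ x₁ x₂ : R) :
    x₀ ^ 2 * 1 ^ 2 + x₁ ^ 4 + x₂ ^ 4 = x₀ ^ 2 + x₁ ^ 4 + x₂ ^ 4 := by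
  ring

/-- Chart `x₀ = 1`: the specimen becomes `z² + x⁴ + y⁴` with `z = x₃`. [folklore] -/
theorem specimen_chart_x0 (x₁ x₂ x₃ : R) :
    1 ^ 2 * x₃ ^ 2 + x₁ ^ 4 + x₂ ^ 4 = x₃ ^ 2 + x₁ ^ 4 + x₂ ^ 4 := by
  ring

/-- Chart `x₁ = 1` is smooth when `2` is a unit: `1 = (x₀²x₃² + 1 + x₂⁴) − ½x₀·∂_{x₀} − ¼x₂·∂_{x₂}`
(`∂_{x₀} = 2x₀x₃²`, `∂_{x₂} = 4x₂³`), so the dehomogenised equation and its partials generate `(1)`.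
[folklore] -/
theorem specimen_chart_x1_smooth (u : R) (hu : u * 2 = 1) (x₀ x₂ x₃ : R) :
    (x₀ ^ 2 * x₃ ^ 2 + 1 + x₂ ^ 4) - (u * x₀) * (2 * x₀ * x₃ ^ 2) - (u * u * x₂) * (4 * x₂ ^ 3) = 1 := by
  linear_combination (-(x₀ ^ 2 * x₃ ^ 2) - x₂ ^ 4 - 2 * u * x₂ ^ 4) * hu

/-- For `f = z² + x⁴ + y⁴` and `2` a unit: `z = ½ ∂_z f`, `x³ = ¼ ∂_x f`, `y³ = ¼ ∂_y f` lie in the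
Jacobian ideal, so `Sing V(f) ⊆ V(x, y, z)`: the affine chart has the origin as its only singular
point. [folklore] -/
theorem specimen_jacobian (u : R) (hu : u * 2 = 1) (x y z : R) :
    z = u * (2 * z) ∧ x ^ 3 = (u * u) * (4 * x ^ 3) ∧ y ^ 3 = (u * u) * (4 * y ^ 3) := by
  refine ⟨?_, ?_, ?_⟩
  · linear_combination (-z) * hu
  · linear_combination (-(x ^ 3) - 2 * u * x ^ 3) * hu
  · linear_combination (-(y ^ 3) - 2 * u * y ^ 3) * hu

/-! ## §2 Blowing up the singular point of `z² + x⁴ + y⁴` -/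

/-- Chart `x`: `y = x y₁`, `z = x z₁`; total transform `= x² · (z₁² + x²(1 + y₁⁴))`. [folklore] -/
theorem pointBlowup_chartX (x y₁ z₁ : R) :
    (x * z₁) ^ 2 + x ^ 4 + (x * y₁) ^ 4 = x ^ 2 * (z₁ ^ 2 + x ^ 2 * (1 + y₁ ^ 4)) := by
  ring

/-- Chart `y`: `x = y x₁`, `z = y z₁`; total transform `= y² · (z₁² + y²(x₁⁴ + 1))`. [folklore] -/
theorem pointBlowup_chartY (y x₁ z₁ : R) :
    (y * z₁) ^ 2 + (y * x₁) ^ 4 + y ^ 4 = y ^ 2 * (z₁ ^ 2 + y ^ 2 * (x₁ ^ 4 + 1)) := by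
  ring

/-- Chart `z`: `x = z x₁`, `y = z y₁`; total transform `= z² · (1 + z²(x₁⁴ + y₁⁴))`. [folklore] -/
theorem pointBlowup_chartZ (z x₁ y₁ : R) :
    z ^ 2 + (z * x₁) ^ 4 + (z * y₁) ^ 4 = z ^ 2 * (1 + z ^ 2 * (x₁ ^ 4 + y₁ ^ 4)) := by
  ring

/-- In the `z`-chart the strict transform `1 + z²(x₁⁴ + y₁⁴)` is `≡ 1` modulo the exceptional equation
`z`: it does not meet the exceptional divisor there (certificate `(1 + z²g) − z·(zg) = 1`). [folklore] -/
theorem pointBlowup_chartZ_misses (z x₁ y₁ : R) :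
    (1 + z ^ 2 * (x₁ ^ 4 + y₁ ^ 4)) - z * (z * (x₁ ^ 4 + y₁ ^ 4)) = 1 := by
  ring

/-! ## §3 The strict transform `H₁ = V(z₁² + x²(1 + y₁⁴))` is singular exactly along the carrier line -/

/-- `f₁ = z₁² + x²(1 + y₁⁴)` lies in `(x, z₁)²`: `H₁` has multiplicity `2` along the exceptional line
`ℓ = {x = z₁ = 0}` of the carrier `E = {x = 0}` (an `A₁` double line where `1 + y₁⁴ ≠ 0`). [folklore] -/
theorem strictTransform_mem_sq (x y₁ z₁ : R) :
    z₁ ^ 2 + x ^ 2 * (1 + y₁ ^ 4) ∈ (Ideal.span ({x, z₁} : Set R)) ^ 2 := by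
  have hx : x ∈ Ideal.span ({x, z₁} : Set R) := Ideal.subset_span (by simp)
  have hz : z₁ ∈ Ideal.span ({x, z₁} : Set R) := Ideal.subset_span (by simp)
  have h1 : z₁ ^ 2 ∈ (Ideal.span ({x, z₁} : Set R)) ^ 2 := Ideal.pow_mem_pow hz 2
  have h2 : x ^ 2 * (1 + y₁ ^ 4) ∈ (Ideal.span ({x, z₁} : Set R)) ^ 2 :=
    Ideal.mul_mem_right _ _ (Ideal.pow_mem_pow hx 2)
  exact Ideal.add_mem _ h1 h2

/-- `H₁ ∩ E = 2ℓ`: modulo the exceptional equation `x`, `f₁ ≡ z₁²` — the strict transform meets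
the carrier `E = {x = 0} ≅ 𝔸²_{y₁,z₁}` in the DOUBLED line `z₁² = 0` (the «doubled plane cone»
situation of H-CONE: the exceptional line lies on `H₁`). [folklore] -/
theorem strictTransform_sub_sq_eq (x y₁ z₁ : R) :
    (z₁ ^ 2 + x ^ 2 * (1 + y₁ ^ 4)) - z₁ ^ 2 = x * (x * (1 + y₁ ^ 4)) := by
  ring

/-- Jacobian certificate for `f₁ = z₁² + x²(1 + y₁⁴)` (`2` a unit): `z₁ = ½∂_{z₁}f₁` and
`x² = ½x·∂_x f₁ − ¼y₁·∂_{y₁} f₁` (`∂_x f₁ = 2x(1 + y₁⁴)`, `∂_{y₁} f₁ = 4x²y₁³`, `∂_{z₁} f₁ = 2z₁`), so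
`Sing H₁ ⊆ V(z₁, x²) = ℓ`: after the point blow-up the singular locus is the whole LINE `ℓ` (no longer
isolated), the next centre. [folklore] -/
theorem strictTransform_jacobian (u : R) (hu : u * 2 = 1) (x y₁ z₁ : R) :
    z₁ = u * (2 * z₁) ∧
      x ^ 2 = (u * x) * (2 * x * (1 + y₁ ^ 4)) - (u * u * y₁) * (4 * x ^ 2 * y₁ ^ 3) := by
  refine ⟨?_, ?_⟩
  · linear_combination (-z₁) * hu
  · linear_combination (-(x ^ 2) + 2 * u * x ^ 2 * y₁ ^ 4) * hu

/-! ## §4 Blowing up the carrier line `ℓ = {x = z₁ = 0}` -/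

/-- Chart `a`: `z₁ = x z₂`; `f₁ = x² · (z₂² + 1 + y₁⁴)`. [folklore] -/
theorem lineBlowup_chartA (x y₁ z₂ : R) :
    (x * z₂) ^ 2 + x ^ 2 * (1 + y₁ ^ 4) = x ^ 2 * (z₂ ^ 2 + 1 + y₁ ^ 4) := by
  ring

/-- Chart `b`: `x = z₁ x₂`; `f₁ = z₁² · (1 + x₂²(1 + y₁⁴))`. [folklore] -/
theorem lineBlowup_chartB (z₁ x₂ y₁ : R) :
    z₁ ^ 2 + (z₁ * x₂) ^ 2 * (1 + y₁ ^ 4) = z₁ ^ 2 * (1 + x₂ ^ 2 * (1 + y₁ ^ 4)) := by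
  ring

/-- The strict transform `f₂ = z₂² + 1 + y₁⁴` of chart `a` is SMOOTH when `2` is a unit:
`f₂ − ½z₂·∂_{z₂}f₂ − ¼y₁·∂_{y₁}f₂ = 1` (`∂_{z₂} = 2z₂`, `∂_{y₁} = 4y₁³`). [folklore] -/
theorem lineBlowup_chartA_smooth (u : R) (hu : u * 2 = 1) (y₁ z₂ : R) :
    (z₂ ^ 2 + 1 + y₁ ^ 4) - (u * z₂) * (2 * z₂) - (u * u * y₁) * (4 * y₁ ^ 3) = 1 := by
  linear_combination (-(z₂ ^ 2) - y₁ ^ 4 - 2 * u * y₁ ^ 4) * hu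

/-- The strict transform `f₂' = 1 + x₂²(1 + y₁⁴)` of chart `b` is SMOOTH when `2` is a unit:
`f₂' − ½x₂·∂_{x₂}f₂' = 1` (`∂_{x₂} = 2x₂(1 + y₁⁴)`). [folklore] -/
theorem lineBlowup_chartB_smooth (u : R) (hu : u * 2 = 1) (x₂ y₁ : R) :
    (1 + x₂ ^ 2 * (1 + y₁ ^ 4)) - (u * x₂) * (2 * x₂ * (1 + y₁ ^ 4)) = 1 := by
  linear_combination (-(x₂ ^ 2 * (1 + y₁ ^ 4))) * hu

/-- The centre `ℓ` lies on `H₁` and the exceptional curve of the line blow-up inside the new strict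
transform (chart `a`, `x = 0`) is `z₂² + 1 + y₁⁴ = 0` — a smooth curve for `2` a unit (same
certificate as `lineBlowup_chartA_smooth` with `x` absent): the resolved surface meets the new
exceptional divisor transversally. [folklore] -/
theorem lineBlowup_exceptional_smooth (u : R) (hu : u * 2 = 1) (y₁ z₂ : R) :
    (z₂ ^ 2 + 1 + y₁ ^ 4) - (u * z₂) * (2 * z₂) - (u * u * y₁) * (4 * y₁ ^ 3) = 1 :=
  lineBlowup_chartA_smooth u hu y₁ z₂

end Summit.ResolutionOfSingularities.ResolutionOfSingularities.Theorems.EquisingularLift.SpecimenQuartic
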